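import Summits.BirchSwinnertonDyer.BirchSwinnertonDyer.Theorems.EisensteinPrimesFullDescentOrdinaryKernelPow
import Literature.NumberTheory.EllipticCurves.GaloisConjugateReductionLayerProofs
import HarnessLib

/-!
# Crux `GoodLatticeBDPValue` (stmt-BirchSwinnertonDyer-19032), line `halves`, AN-3 Stub B road — brick F3c:
# the FROBENIUS BOUND at a good ordinary place: `Γ_{K_v}` trivial on `E[p^r]` mod the kernel ⇒ `p^r ≤ 2 q_v + 1`

Width seat bsd-line-x1-p1-w3 (gen 4). HONEST FRAMING (cell `bsd-eis`, run/shared/lean/pub/bsd-eis/):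
TOOL THEOREM ONLY (no `def`, no named fact, no `sorry`); nothing about a summit statement,
Keller–Yin Thm. 2.2.2 or crux 2 is proved here; 0 stubs / cells / labels move.

WHY (road memo `HOME/line-x1-p1-w3-g4/AN3-StubB-elementary-road.md`, evidence #44 on the item,
step A5 — the END-GAME at the prime `3`). In the elementary proof of Theorem T′
(`HalvesAnThreeSplit.FullDescentAtThreeOfRed`) one arrives at a situation where the whole Galois
group acts trivially on `E[9]` modulo the cyclic kernel-of-reduction line `K₉ = Ê[9]` (bricks F3a/F3b,
`natCard_ker_inf_geomTorsion_pow`, `exists_lines_geomTorsion_sq_of_not_dvd_frobeniusTraceAt`). This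
file proves that this is IMPOSSIBLE over `ℚ` at `3`, in the following general quantitative form: for
the reduction map `f : E(K̄) → MO~(k̄_w)` of the good local model at an ordinary place `v ∣ p`
(hypotheses VERBATIM those of the tree's `goodReduction_reduction_line`), if `f (res τ • x) = f x`
for every `τ ∈ Γ_{K_v}` and every `x ∈ E[p^r]`, then `p^r ≤ 2·q_v + 1` (`q_v = #k_v =
v.residueCard`). Proof: `#f(E[p^r]) = p^{2r}/p^r = p^r` (`card_torsionBy_eq_sq`, brick F3a);
reading the reduced coordinates through the residue map `𝒪_w → k̄_v` at an arithmetic Frobenius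
(`exists_residueMap`, `exists_isArithFrobAt_localAbsIntegers` of `HasseWeilGoodReductionFrobeniusProofs`),
the hypothesis forces `x̄^q = x̄` for the abscissa of every reduction (the Frobenius conjugate of an
integral point reduces to the Frobenius of the reduction), so the `p^r` reductions inject into
`{O} ∪ {(α, β) : α^q = α, β a root of the Weierstrass quadratic at α}`, a set with at most
`1 + 2·#{roots of X^q − X} ≤ 2q + 1` elements. For `K = ℚ`, `v = 3`, `r = 2`: `9 ≤ 7`, absurd.

* `pow_le_two_mul_residueCard_add_one_of_forall_apply_smul_eq` — the bound above.

References: [GreenbergLNM1716] §1 p. 62, §2 p. 70 (the finite group `Ẽ(f)`); [SilvermanAEC2009] VII.§2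
Prop. VII.2.1, VII.3.1, Ex. 5.10 (`#Ẽ(𝔽_q) ≤ 2q + 1`); [SerreLocalFields1979] II §4 Prop. 8.
-/

noncomputable section

open scoped Classical NNReal NumberField AddSubgroup
open NumberField IsDedekindDomain Polynomial

set_option autoImplicit false
set_option linter.dupNamespace false

namespace Summit.BirchSwinnertonDyer.BirchSwinnertonDyer.Theorems.FullDescentOrdinary

open _root_.WeierstrassCurve Literature.NumberTheory.EllipticCurves Literature.NumberTheory.GaloisRepresentations
  Field IsDedekindDomain.HeightOneSpectrum

/-- **The Frobenius bound** (memo A5): at a good ordinary place `v ∣ p`, if the whole decomposition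
group `Γ_{K_v}` acts trivially on `E[p^r]` MODULO the kernel of reduction (`f (res τ • x) = f x` for
all `x ∈ E[p^r]`), then `p^r ≤ 2·#k_v + 1`: the `p^r` reductions `f(E[p^r])` are points of
`Ẽ(k̄_v)` whose coordinates are fixed by the `q`-Frobenius (`x̄^q = x̄`, read through the residue
map `𝒪_w → k̄_v` of `exists_residueMap` at an arithmetic Frobenius,
`exists_isArithFrobAt_localAbsIntegers`), and a Weierstrass cubic has at most two ordinates over
each of the `≤ q` roots of `X^q − X`. For `K = ℚ`, `v = 3`, `r = 2` this reads `9 ≤ 7`: the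
contradiction closing the elementary proof of Theorem T′.
[cite: GreenbergLNM1716, §2 p. 70] [cite: SilvermanAEC2009, VII.§2, Ex. 5.10] -/
theorem pow_le_two_mul_residueCard_add_one_of_forall_apply_smul_eq {K : Type} [Field K] [NumberField K]
    (W : WeierstrassCurve K) [W.IsElliptic] (p : ℕ) [hp : Fact p.Prime]
    (v : HeightOneSpectrum (𝓞 K)) (hpv : (p : 𝓞 K) ∈ v.asIdeal) (hgood : W.HasGoodReductionAt v)
    (hord : ¬ ((p : ℤ) ∣ W.frobeniusTraceAt v))
    {w : Valuation (AlgebraicClosure (v.adicCompletion K)) ℝ≥0}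
    (hw : ∀ x, (w x : ℝ) =
      spectralNorm (v.adicCompletion K) (AlgebraicClosure (v.adicCompletion K)) x)
    {φ : v.adicCompletionIntegers K →+* w.valuationSubring}
    (hΔO : IsUnit ((W.localMinimalIntegralModel v).map φ).Δ)
    (hX : ((W.localMinimalIntegralModel v).map
        (algebraMap (v.adicCompletionIntegers K) (v.adicCompletion K))).baseChange
          (AlgebraicClosure (v.adicCompletion K)) =
        ((W.localMinimalIntegralModel v).map φ).baseChange (AlgebraicClosure (v.adicCompletion K)))
    (Φ₀ : localPoints W (v.adicCompletion K) ≃+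
      (((W.localMinimalIntegralModel v).map
        (algebraMap (v.adicCompletionIntegers K) (v.adicCompletion K))).baseChange
          (AlgebraicClosure (v.adicCompletion K))).toAffine.Point)
    (hΦ₀ : ∀ (σ : absoluteGaloisGroup (v.adicCompletion K)) (Q : localPoints W (v.adicCompletion K)),
      Φ₀ (σ • Q) = Affine.Point.map
        ((absoluteGaloisGroup.toAlgEquiv (v.adicCompletion K) σ :
            AlgebraicClosure (v.adicCompletion K) ≃ₐ[v.adicCompletion K]
              AlgebraicClosure (v.adicCompletion K)) :
          AlgebraicClosure (v.adicCompletion K) →ₐ[v.adicCompletion K]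
            AlgebraicClosure (v.adicCompletion K)) (Φ₀ Q))
    (f : geomPoints W →+
      (((W.localMinimalIntegralModel v).map φ).map (IsLocalRing.residue w.valuationSubring)).toAffine.Point)
    (hf : ∀ a, f a = goodReductionHom ((W.localMinimalIntegralModel v).map φ)
      (Valuation.valuationSubring.integers w) hΔO
      (Affine.Point.congrEquiv hX (Φ₀ (pointsMap W (v.adicCompletion K) a)))) (r : ℕ)
    (htriv : ∀ (τ : absoluteGaloisGroup (v.adicCompletion K)), ∀ x ∈ geomTorsion W ((p ^ r : ℕ) : ℤ),
      f (absGaloisRestrict K (v.adicCompletion K) τ • x) = f x) :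
    p ^ r ≤ 2 * v.residueCard + 1 := by
  haveI : CharZero (v.adicCompletion K) :=
    charZero_of_injective_algebraMap (algebraMap K (v.adicCompletion K)).injective
  haveI : CharZero (AlgebraicClosure (v.adicCompletion K)) :=
    charZero_of_injective_algebraMap
      (algebraMap (v.adicCompletion K) (AlgebraicClosure (v.adicCompletion K))).injective
  have hvO : w.Integers w.valuationSubring := Valuation.valuationSubring.integers w
  haveI hMOell : ((W.localMinimalIntegralModel v).map φ).IsElliptic := ⟨hΔO⟩
  haveI := isElliptic_map_residue (W := (W.localMinimalIntegralModel v).map φ) hΔO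
  set red := goodReductionHom ((W.localMinimalIntegralModel v).map φ) hvO hΔO with hreddef
  -- sizes: `#E[p^r] = p^{2r}`, `#(ker f ∩ E[p^r]) = p^r`, so `#f(E[p^r]) = p^r`
  set T : AddSubgroup (geomPoints W) := geomTorsion W ((p ^ r : ℕ) : ℤ) with hTdef
  have hpr0 : p ^ r ≠ 0 := pow_ne_zero r hp.out.ne_zero
  have hT : Nat.card T = (p ^ r) ^ 2 :=
    card_torsionBy_eq_sq (E := W.baseChange (AlgebraicClosure K)) (n := p ^ r) (by exact_mod_cast hpr0)
  obtain ⟨hker, -⟩ := natCard_ker_inf_geomTorsion_pow W p v hpv hgood hord hw hΔO hX Φ₀ f hf r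
  set fT : T →+ _ := f.comp T.subtype with hfTdef
  have hkerT : Nat.card fT.ker = p ^ r := by
    rw [← hker]
    refine Nat.card_congr ⟨fun x ↦ ⟨x.1.1, AddSubgroup.mem_inf.mpr ⟨x.2, x.1.2⟩⟩,
      fun y ↦ ⟨⟨y.1, (AddSubgroup.mem_inf.mp y.2).2⟩, (AddSubgroup.mem_inf.mp y.2).1⟩,
      fun x ↦ rfl, fun y ↦ rfl⟩
  haveI : Finite T := Nat.finite_of_card_ne_zero (by rw [hT]; positivity)
  have hrange : Nat.card fT.range = p ^ r := by
    have h1 := AddSubgroup.card_eq_card_quotient_mul_card_addSubgroup fT.ker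
    rw [hT, hkerT, Nat.card_congr (QuotientAddGroup.quotientKerEquivRange fT).toEquiv, pow_two] at h1
    exact (Nat.eq_of_mul_eq_mul_right (Nat.pos_of_ne_zero hpr0) h1.symm)
  -- Frobenius at `v` and the residue map `𝒪_w → k̄_v`
  obtain ⟨𝔐, h𝔐⟩ := v.localPrimesAbove_nonempty
  obtain ⟨τ, hτ⟩ := exists_isArithFrobAt_localAbsIntegers v h𝔐
  obtain ⟨rm, hrm, -, hrmF⟩ := exists_residueMap (v := v) hw h𝔐
  haveI hkfin : Finite (IsLocalRing.ResidueField (v.adicCompletionIntegers K)) := Nat.finite_of_card_ne_zero (by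
    rw [natCard_residueField_eq_residueCard]; exact (v.one_lt_residueCard).ne_bot)
  set q := Nat.card (IsLocalRing.ResidueField (v.adicCompletionIntegers K)) with hq
  have hq1 : 1 < q := by rw [hq]; exact Finite.one_lt_card
  have hqv : q = v.residueCard := by rw [hq, natCard_residueField_eq_residueCard]
  -- `rm` factors through the residue field of `𝒪_w`
  have hkerm : ∀ a ∈ IsLocalRing.maximalIdeal w.valuationSubring, rm a = 0 := by
    intro a ha
    rw [IsLocalRing.mem_maximalIdeal, mem_nonunits_iff, hvO.isUnit_iff_valuation_eq_one] at ha
    exact (hrm a).mpr (lt_of_le_of_ne ((Valuation.mem_valuationSubring_iff w _).mp a.2) ha)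
  let rt : IsLocalRing.ResidueField w.valuationSubring →+* (AlgebraicClosure (IsLocalRing.ResidueField (v.adicCompletionIntegers K))) :=
    Ideal.Quotient.lift (IsLocalRing.maximalIdeal w.valuationSubring) rm hkerm
  have hrt : ∀ a, rt (IsLocalRing.residue w.valuationSubring a) = rm a := fun a ↦
    Ideal.Quotient.lift_mk _ _ _
  have hrt_inj : Function.Injective rt := RingHom.injective _
  -- the coordinate code of a reduced point
  let code : (((W.localMinimalIntegralModel v).map φ).map (IsLocalRing.residue w.valuationSubring)).toAffine.Point → Option ((AlgebraicClosure (IsLocalRing.ResidueField (v.adicCompletionIntegers K))) × (AlgebraicClosure (IsLocalRing.ResidueField (v.adicCompletionIntegers K)))) :=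
    fun Q ↦ match Q with
      | .zero => none
      | .some a b _ => some (rt a, rt b)
  have hcode : Function.Injective code := by
    rintro (_ | ⟨x₁, y₁, h₁⟩) (_ | ⟨x₂, y₂, h₂⟩) hQ
    · rfl
    · exact absurd hQ (by simp [code])
    · exact absurd hQ (by simp [code])
    · simp only [code, Option.some.injEq, Prod.mk.injEq] at hQ
      obtain ⟨e1, e2⟩ := hQ
      cases hrt_inj e1; cases hrt_inj e2
      rfl
  -- the finite target set
  set R : Finset (AlgebraicClosure (IsLocalRing.ResidueField (v.adicCompletionIntegers K))) := (X ^ q - X : (AlgebraicClosure (IsLocalRing.ResidueField (v.adicCompletionIntegers K)))[X]).roots.toFinset with hRdef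
  set Wk := (((W.localMinimalIntegralModel v).map φ).map (IsLocalRing.residue w.valuationSubring)).map rt
    with hWk
  set quad : (AlgebraicClosure (IsLocalRing.ResidueField (v.adicCompletionIntegers K))) → (AlgebraicClosure (IsLocalRing.ResidueField (v.adicCompletionIntegers K)))[X] := fun α ↦
    C 1 * X ^ 2 + C (Wk.a₁ * α + Wk.a₃) * X + C (-(α ^ 3 + Wk.a₂ * α ^ 2 + Wk.a₄ * α + Wk.a₆)) with hquad
  set S : Finset (Option ((AlgebraicClosure (IsLocalRing.ResidueField (v.adicCompletionIntegers K))) × (AlgebraicClosure (IsLocalRing.ResidueField (v.adicCompletionIntegers K))))) :=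
    insert none (R.biUnion fun α ↦ ((quad α).roots.toFinset.image fun β ↦ some (α, β))) with hSdef
  have hRcard : R.card ≤ q := by
    rw [hRdef]
    refine (Multiset.toFinset_card_le _).trans ?_
    refine (Polynomial.card_roots' _).trans ?_
    rw [FiniteField.X_pow_card_sub_X_natDegree_eq (AlgebraicClosure (IsLocalRing.ResidueField (v.adicCompletionIntegers K))) hq1]
  have hquadcard : ∀ α, ((quad α).roots.toFinset.image fun β ↦ (some (α, β) : Option ((AlgebraicClosure (IsLocalRing.ResidueField (v.adicCompletionIntegers K))) × (AlgebraicClosure (IsLocalRing.ResidueField (v.adicCompletionIntegers K)))))).card ≤ 2 := by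
    intro α
    refine Finset.card_image_le.trans ((Multiset.toFinset_card_le _).trans ?_)
    refine (Polynomial.card_roots' _).trans ?_
    rw [hquad, Polynomial.natDegree_quadratic one_ne_zero]
  have hScard : S.card ≤ 2 * q + 1 := by
    rw [hSdef]
    refine (Finset.card_insert_le _ _).trans ?_
    rw [Nat.add_le_add_iff_right]
    refine Finset.card_biUnion_le.trans ?_
    calc ∑ α ∈ R, ((quad α).roots.toFinset.image fun β ↦ (some (α, β) : Option ((AlgebraicClosure (IsLocalRing.ResidueField (v.adicCompletionIntegers K))) × (AlgebraicClosure (IsLocalRing.ResidueField (v.adicCompletionIntegers K)))))).card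
        ≤ ∑ _α ∈ R, 2 := Finset.sum_le_sum fun α _ ↦ hquadcard α
      _ = 2 * R.card := by rw [Finset.sum_const, smul_eq_mul, mul_comm]
      _ ≤ 2 * q := by gcongr
  -- the Galois action through the transport
  let σE : absoluteGaloisGroup (v.adicCompletion K) → ((AlgebraicClosure (v.adicCompletion K)) →ₐ[v.adicCompletion K] (AlgebraicClosure (v.adicCompletion K))) := fun σ ↦
    ((absoluteGaloisGroup.toAlgEquiv (v.adicCompletion K) σ : (AlgebraicClosure (v.adicCompletion K)) ≃ₐ[v.adicCompletion K] (AlgebraicClosure (v.adicCompletion K))) :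
      (AlgebraicClosure (v.adicCompletion K)) →ₐ[v.adicCompletion K] (AlgebraicClosure (v.adicCompletion K)))
  have hfσ : ∀ (σ : absoluteGaloisGroup (v.adicCompletion K)) (a : geomPoints W),
      f (absGaloisRestrict K (v.adicCompletion K) σ • a) =
        red (Affine.Point.congrEquiv hX (Affine.Point.map (σE σ)
          (Φ₀ (pointsMap W (v.adicCompletion K) a)))) := by
    intro σ a
    rw [hf, ← resGal_eq_absGaloisRestrict, pointsMap_smul, hΦ₀]
  have hσw : ∀ (σ : absoluteGaloisGroup (v.adicCompletion K)) (z : (AlgebraicClosure (v.adicCompletion K))), w (σE σ z) = w z :=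
    fun σ z ↦ spectralValuation_smul hw σ z
  -- reductions of integral points of `((W.localMinimalIntegralModel v).map φ)(K̄_v)`
  have hredO : ∀ (a b : w.valuationSubring)
      (hab : (((W.localMinimalIntegralModel v).map φ).baseChange (AlgebraicClosure (v.adicCompletion K))).toAffine.Nonsingular (algebraMap w.valuationSubring (AlgebraicClosure (v.adicCompletion K)) a)
        (algebraMap w.valuationSubring (AlgebraicClosure (v.adicCompletion K)) b)),
      ∃ hns, red (.some _ _ hab) =
        .some (IsLocalRing.residue w.valuationSubring a) (IsLocalRing.residue w.valuationSubring b) hns := by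
    intro a b hab
    have heqO : ((W.localMinimalIntegralModel v).map φ).toAffine.Equation a b := (map_equation_iff hvO.hom_inj).mp hab.1
    have hns : (((W.localMinimalIntegralModel v).map φ).map (IsLocalRing.residue w.valuationSubring)).toAffine.Nonsingular
        (IsLocalRing.residue w.valuationSubring a) (IsLocalRing.residue w.valuationSubring b) :=
      (Affine.equation_iff_nonsingular).mp (heqO.map (IsLocalRing.residue w.valuationSubring))
    exact ⟨hns, by rw [hreddef, goodReductionHom_apply]; exact reducePoint_some_algebraMap hvO.hom_inj hab hns⟩
  -- MAIN CLAIM: every value `f x`, `x ∈ E[p^r]`, has its code in `S`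
  have hmem : ∀ x ∈ T, code (f x) ∈ S := by
    intro x hx
    obtain ⟨P₀, hP₀⟩ : ∃ P₀, Φ₀ (pointsMap W (v.adicCompletion K) x) = P₀ := ⟨_, rfl⟩
    have hfx : f x = red (Affine.Point.congrEquiv hX P₀) := by rw [hf, hP₀]
    have hfτx : f (absGaloisRestrict K (v.adicCompletion K) τ • x) =
        red (Affine.Point.congrEquiv hX (Affine.Point.map (σE τ) P₀)) := by rw [hfσ, hP₀]
    rcases P₀ with _ | ⟨x₀, y₀, h₀⟩
    · -- `P₀ = O`
      have : f x = 0 := by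
        rw [hfx]
        exact (congrArg red (Affine.Point.congrEquiv_zero hX)).trans (map_zero red)
      rw [this, hSdef]
      exact Finset.mem_insert_self _ _
    · have h₀' : (((W.localMinimalIntegralModel v).map φ).baseChange (AlgebraicClosure (v.adicCompletion K))).toAffine.Nonsingular x₀ y₀ := hX ▸ h₀
      have hP : Affine.Point.congrEquiv hX (.some x₀ y₀ h₀) = .some x₀ y₀ h₀' :=
        Affine.Point.congrEquiv_some hX h₀
      by_cases hx₀ : w x₀ ≤ 1
      · -- integral point: `x₀ = a`, `y₀ = b` with `a b ∈ 𝒪_w`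
        obtain ⟨a, ha⟩ := hvO.exists_of_le_one hx₀
        have hy₀ : w y₀ ≤ 1 := v_Y_le_one_of_v_X_le_one hvO h₀'.1 hx₀
        obtain ⟨b, hb⟩ := hvO.exists_of_le_one hy₀
        subst ha hb
        obtain ⟨hns, hredP⟩ := hredO a b h₀'
        have heqO : ((W.localMinimalIntegralModel v).map φ).toAffine.Equation a b := (map_equation_iff hvO.hom_inj).mp h₀'.1
        have hfx' : f x = .some (IsLocalRing.residue w.valuationSubring a)
            (IsLocalRing.residue w.valuationSubring b) hns := by rw [hfx, hP, hredP]
        -- the Frobenius conjugate is the integral point `(τ a, τ b)`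
        have hτa : w (σE τ (algebraMap w.valuationSubring (AlgebraicClosure (v.adicCompletion K)) a)) ≤ 1 := (hσw τ _).le.trans hx₀
        have hτb : w (σE τ (algebraMap w.valuationSubring (AlgebraicClosure (v.adicCompletion K)) b)) ≤ 1 := (hσw τ _).le.trans hy₀
        set a' : w.valuationSubring := ⟨σE τ (algebraMap w.valuationSubring (AlgebraicClosure (v.adicCompletion K)) a),
          (Valuation.mem_valuationSubring_iff w _).mpr hτa⟩ with ha'
        set b' : w.valuationSubring := ⟨σE τ (algebraMap w.valuationSubring (AlgebraicClosure (v.adicCompletion K)) b),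
          (Valuation.mem_valuationSubring_iff w _).mpr hτb⟩ with hb'
        have hPτ : ∃ hh, Affine.Point.congrEquiv hX (Affine.Point.map (σE τ) (.some _ _ h₀)) =
            .some (algebraMap w.valuationSubring (AlgebraicClosure (v.adicCompletion K)) a')
              (algebraMap w.valuationSubring (AlgebraicClosure (v.adicCompletion K)) b') hh := by
          rw [Affine.Point.map_some, Affine.Point.congrEquiv_some]
          exact ⟨_, rfl⟩
        obtain ⟨hh, hPτ⟩ := hPτ
        obtain ⟨hns', hredP'⟩ := hredO a' b' hh
        rw [hPτ, hredP', htriv τ x hx, hfx'] at hfτx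
        -- equal reductions: `residue a' = residue a`, so `rm a = rm a' = (rm a)^q`
        have hres : IsLocalRing.residue w.valuationSubring a = IsLocalRing.residue w.valuationSubring a' := by
          have h := hfτx
          simp only [Affine.Point.some.injEq] at h
          exact h.1
        have hfrob : rm a ^ q = rm a := by
          have h1 : rm a = rm a' := by rw [← hrt, ← hrt, hres]
          have h2 : rm a' = rm a ^ q := hrmF hτ a hτa
          rw [← h2, ← h1]
        -- `α = rt (residue a) = rm a ∈ R`
        have hXq0 : (X ^ q - X : (AlgebraicClosure (IsLocalRing.ResidueField (v.adicCompletionIntegers K)))[X]) ≠ 0 :=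
          FiniteField.X_pow_card_sub_X_ne_zero _ hq1
        have hfrob' : rt (IsLocalRing.residue w.valuationSubring a) ^ q =
            rt (IsLocalRing.residue w.valuationSubring a) := by rw [hrt]; exact hfrob
        have hαR : rt (IsLocalRing.residue w.valuationSubring a) ∈ R := by
          rw [hRdef, Multiset.mem_toFinset, Polynomial.mem_roots hXq0, Polynomial.IsRoot, eval_sub,
            eval_pow, eval_X, hfrob', sub_self]
        -- `β = rt (residue b)` is a root of the quadratic at `α`
        have heqk := (heqO.map (IsLocalRing.residue w.valuationSubring)).map rt
        rw [Affine.equation_iff] at heqk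
        have hquad0 : quad (rt (IsLocalRing.residue w.valuationSubring a)) ≠ 0 := by
          intro h0
          have := congrArg Polynomial.natDegree h0
          rw [hquad, Polynomial.natDegree_quadratic one_ne_zero, Polynomial.natDegree_zero] at this
          exact two_ne_zero this
        have hβ : rt (IsLocalRing.residue w.valuationSubring b) ∈
            (quad (rt (IsLocalRing.residue w.valuationSubring a))).roots.toFinset := by
          rw [Multiset.mem_toFinset, Polynomial.mem_roots hquad0, Polynomial.IsRoot, hquad]
          simp only [eval_add, eval_mul, eval_C, eval_pow, eval_X, one_mul]
          linear_combination heqk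
        -- conclusion of the claim
        rw [hfx']
        change some (rt (IsLocalRing.residue w.valuationSubring a), rt (IsLocalRing.residue w.valuationSubring b)) ∈ S
        rw [hSdef]
        refine Finset.mem_insert_of_mem (Finset.mem_biUnion.mpr ⟨_, hαR, ?_⟩)
        exact Finset.mem_image.mpr ⟨_, hβ, rfl⟩
      · -- non-integral point: reduces to `O`
        have : f x = 0 := by
          rw [hfx, hP, hreddef, goodReductionHom_eq_zero_iff]
          exact (reducesToZero_some_iff h₀').mpr ((not_mem_range_iff hvO).mpr (not_le.mp hx₀))
        rw [this, hSdef]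
        exact Finset.mem_insert_self _ _
  -- conclusion: `p^r = #f(E[p^r]) ≤ #S ≤ 2q + 1`
  have hmemr : ∀ y : fT.range, code y.1 ∈ S := by
    rintro ⟨y, x, rfl⟩
    exact hmem x x.2
  have hinj : Function.Injective (fun y : fT.range ↦ (⟨code y.1, hmemr y⟩ : S)) := by
    intro y₁ y₂ h
    exact Subtype.ext (hcode (congrArg Subtype.val h))
  have hle : Nat.card fT.range ≤ Nat.card S := Nat.card_le_card_of_injective _ hinj
  rw [hrange, Nat.card_eq_finsetCard] at hle
  rw [← hqv]
  exact hle.trans hScard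

end Summit.BirchSwinnertonDyer.BirchSwinnertonDyer.Theorems.FullDescentOrdinary
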